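import Literature.Computation.Certificates.StrassmannDiscCertificate
import Mathlib.Analysis.SpecificLimits.Normed
import Mathlib.NumberTheory.Padics.PadicIntegers
import Mathlib.Analysis.Normed.Group.Ultra
import HarnessLib

/-!
# Coleman disc series: the tail bound and the convergence clause of a Strassman disc certificate

Topic `Literature/Computation/Certificates`; namespace `Literature.Computation.Certificates.StrassmannDiscCert`
(this file extends `StrassmannDiscCertificate.lean`). A Strassman disc certificate
(`StrassmannDiscCert`: valuation table for `a₀ … a_M`, index `k`, exact valuation `e`, tail bound) certifies
«at most `k` zeros in `ℤ_p`» of `u ↦ Σ aₙ uⁿ` PROVIDED the actual coefficient sequence `a : ℕ → ℚ_[p]` is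
DESCRIBED by it (`DescribesPadic`): (i) `aₙ → 0`, (ii) `a_k ≠ 0` with `v_p(a_k) = e`, (iii) the tabulated bounds,
(iv) `v_p(aₙ) ≥ tail` beyond the table. For the disc functions of the Chabauty–Coleman method the series has the
shape of an antiderivative evaluated on a disc of radius `|p|`: with a local parameter `t = p·u` and an
annihilating differential whose local expansion `Σ_m b_m t^m dt` has `p`-INTEGRAL coefficients of valuation
`≥ v` (Stoll, *Compositio* 142 (2006) §6, proof of Prop. 6.3: `λ(T) = c + a₀πT + ⋯ + a_m π^{m+1}T^{m+1}/(m+1) + ⋯`),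
the coefficients are `aₙ = pⁿ·b_{n−1}/n` for `n ≥ 1`, so `n·aₙ ∈ p^{n+v}ℤ_p`. This file PROVES that this single
integrality property discharges clauses (i) and (iv):

* `valuation_ge_of_integral` — `n·aₙ ∈ p^{n+v}ℤ_p` (stated in valuations) gives
  `v_p(aₙ) ≥ n + v − v_p(n) ≥ n + v − ⌊log_p n⌋`;
* `tailBound_mono` — `n ↦ n + v − ⌊log_p n⌋` is monotone, so beyond a table of length `M + 1` every coefficient
  has valuation `≥ T := M + 1 + v − ⌊log_p(M+1)⌋` — exactly the tail bound the exact checker `ratpcert` (kind CC,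
  `pub/certnum/nt/FORMAT-ratpcert-v0.md` §17) writes into the certificates it emits;
* `tendsto_zero_of_integral` — such a sequence tends to `0` (`‖aₙ‖ ≤ p^{−v}·n·p^{−n}`);
* **`describesPadic_of_integral`** — (ii) + (iii) on the table + integrality + `tail ≤ T` ⇒ `DescribesPadic`;
* **`card_le_of_zeros_padicInt_of_integral`** — the consumption form: with `check = true` (by `decide` on the
  literal certificate) any finite set of zeros in `ℤ_p` has at most `k` elements;
* `integral_of_antiderivative` — the antiderivative shape `aₙ = pⁿ b_{n−1}/n`, `v ≤ v_p(b_m)`, gives the integrality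
  hypothesis; `comb_eq_zero_or_le_valuation` / `integral_of_comb_antiderivative` — the same from `b_m = Σ cᵢ ηᵢ(m)` with
  `ηᵢ(m) ∈ ℤ_p` (ultrametric inequality; `eq_zero_or_le_valuation_iff_norm_le` is the norm/valuation dictionary).

What stays OUTSIDE this file (hypotheses of the consumer, as in `StrassmannDiscCertificate.lean`): Coleman's theorem
(rational points of the disc are zeros of the integral), the integrality of the local expansion of the differential
(Newton–Hensel iteration from `p`-unit data — verified by the checker on the computed range, a lemma on formal
power series in general), and the residues `a₀ … a_M` themselves (exact arithmetic). No named fact is used in any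
proof; everything here is elementary valuation bookkeeping.

## References

* M. Stoll, Independence of rational points on twists of a given curve, Compositio Math. 142 (2006) 1201–1214,
  §6 (proof of Prop. 6.3: the disc logarithm `λ(T)` and the «standard Newton polygon argument»).
  [Stoll2006IndependenceTwists]
* R. F. Coleman, Effective Chabauty, Duke Math. J. 52 (1985) 765–770, §1 (ii). [Coleman1985EffectiveChabauty]
* F. Q. Gouvêa, *p-adic Numbers*, Springer 1993, §5.6 Thm. 5.6.1 (Strassman). [Gouvea1993PadicNumbers]
-/

noncomputable section

open Filter Topology

namespace Literature.Computation.Certificates.StrassmannDiscCert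

variable {p : ℕ} [hp : Fact p.Prime]

/-- `⌊log_p(n+1)⌋ ≤ ⌊log_p n⌋ + 1` (for `n = 0` both logarithms vanish; for `n ≥ 1`, `n + 1 ≤ n·p`).
[cite: Stoll2006IndependenceTwists, §6 (definition of δ(v,n): the function n + 1 − v(n+1))] -/
theorem natLog_succ_le_succ (n : ℕ) : Nat.log p (n + 1) ≤ Nat.log p n + 1 := by
  have hp1 : 1 < p := hp.out.one_lt
  rcases Nat.eq_zero_or_pos n with rfl | hn
  · simp
  · calc Nat.log p (n + 1) ≤ Nat.log p (n * p) := Nat.log_mono_right (by nlinarith)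
      _ = Nat.log p n + 1 := Nat.log_mul_base hp1 hn.ne'

/-- The tail-bound function `n ↦ n + v − ⌊log_p n⌋` is monotone: once the table of a certificate ends at index
`M`, `T = M + 1 + v − ⌊log_p(M+1)⌋` bounds the valuation of every later coefficient.
[cite: Stoll2006IndependenceTwists, §6 (δ(v,n) and the Newton polygon of λ(T))] -/
theorem tailBound_mono (v : ℤ) : Monotone fun n : ℕ => (n : ℤ) + v - (Nat.log p n : ℤ) := by
  refine monotone_nat_of_le_succ fun n => ?_
  have h := natLog_succ_le_succ (p := p) n
  simp only [Nat.cast_add, Nat.cast_one]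
  omega

/-- **The valuation bookkeeping of a disc antiderivative.** If `n·aₙ` has valuation `≥ n + v` (i.e.
`n·aₙ ∈ p^{n+v}ℤ_p`), then `v_p(aₙ) ≥ n + v − v_p(n) ≥ n + v − ⌊log_p n⌋` (or `aₙ = 0`).
[cite: Stoll2006IndependenceTwists, §6 proof of Prop. 6.3 (coefficients a_m π^{m+1}/(m+1) of λ(T))] -/
theorem valuation_ge_of_integral {a : ℚ_[p]} {n : ℕ} (hn : n ≠ 0) {v : ℤ}
    (h : a = 0 ∨ (n : ℤ) + v ≤ ((n : ℚ_[p]) * a).valuation) :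
    a = 0 ∨ (n : ℤ) + v - (Nat.log p n : ℤ) ≤ a.valuation := by
  rcases h with h0 | hv
  · exact Or.inl h0
  · by_cases ha : a = 0
    · exact Or.inl ha
    · right
      have hn' : (n : ℚ_[p]) ≠ 0 := Nat.cast_ne_zero.2 hn
      rw [Padic.valuation_mul hn' ha, Padic.valuation_natCast] at hv
      have hlog : (padicValNat p n : ℤ) ≤ (Nat.log p n : ℤ) := Nat.cast_le.2 (padicValNat_le_nat_log n)
      omega

/-- Norm form of `valuation_ge_of_integral`: `‖aₙ‖ ≤ p^{−v} · n · (p⁻¹)ⁿ` for `n ≥ 1`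
(`p^{⌊log_p n⌋} ≤ n`). [cite: Stoll2006IndependenceTwists, §6 proof of Prop. 6.3] -/
theorem norm_le_of_integral {a : ℚ_[p]} {n : ℕ} (hn : n ≠ 0) {v : ℤ}
    (h : a = 0 ∨ (n : ℤ) + v ≤ ((n : ℚ_[p]) * a).valuation) :
    ‖a‖ ≤ (p : ℝ) ^ (-v) * ((n : ℝ) * ((p : ℝ)⁻¹) ^ n) := by
  have hp1 : (1 : ℝ) < p := Nat.one_lt_cast.2 hp.out.one_lt
  have hp0 : (0 : ℝ) < p := by positivity
  rcases valuation_ge_of_integral hn h with h0 | hv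
  · rw [h0, norm_zero]; positivity
  · by_cases ha : a = 0
    · rw [ha, norm_zero]; positivity
    · rw [Padic.norm_eq_zpow_neg_valuation ha]
      have hlogle : (p : ℝ) ^ (Nat.log p n : ℤ) ≤ (n : ℝ) := by
        rw [zpow_natCast]
        exact_mod_cast Nat.pow_log_le_self p hn
      calc (p : ℝ) ^ (-a.valuation) ≤ (p : ℝ) ^ (-((n : ℤ) + v - (Nat.log p n : ℤ))) :=
            zpow_le_zpow_right₀ hp1.le (by omega)
        _ = (p : ℝ) ^ (-v) * ((p : ℝ) ^ (Nat.log p n : ℤ) * ((p : ℝ)⁻¹) ^ n) := by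
            rw [inv_pow, ← zpow_natCast (p : ℝ) n, ← zpow_neg, ← zpow_add₀ hp0.ne', ← zpow_add₀ hp0.ne']
            congr 1; ring
        _ ≤ (p : ℝ) ^ (-v) * ((n : ℝ) * ((p : ℝ)⁻¹) ^ n) := by
            gcongr

/-- **Convergence clause.** A coefficient sequence with `n·aₙ ∈ p^{n+v}ℤ_p` for all `n ≥ 1` tends to `0` — clause
(i) of `DescribesPadic` (the disc function converges on the closed unit disc `|u| ≤ 1`, i.e. `|t| ≤ |p|`).
[cite: Stoll2006IndependenceTwists, §6 proof of Prop. 6.3 (λ converges for T ∈ 𝒪)] -/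
theorem tendsto_zero_of_integral {a : ℕ → ℚ_[p]} {v : ℤ}
    (hint : ∀ n, n ≠ 0 → a n = 0 ∨ (n : ℤ) + v ≤ ((n : ℚ_[p]) * a n).valuation) :
    Tendsto a atTop (𝓝 0) := by
  have hp1 : (1 : ℝ) < p := Nat.one_lt_cast.2 hp.out.one_lt
  have hr0 : (0 : ℝ) ≤ (p : ℝ)⁻¹ := by positivity
  have hr1 : (p : ℝ)⁻¹ < 1 := inv_lt_one_of_one_lt₀ hp1
  have hlim : Tendsto (fun n : ℕ => (p : ℝ) ^ (-v) * ((n : ℝ) * ((p : ℝ)⁻¹) ^ n)) atTop (𝓝 0) := by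
    simpa only [mul_zero] using (tendsto_self_mul_const_pow_of_lt_one hr0 hr1).const_mul ((p : ℝ) ^ (-v))
  refine squeeze_zero_norm' ?_ hlim
  filter_upwards [eventually_ne_atTop 0] with n hn
  exact norm_le_of_integral hn (hint n hn)

/-- **Tail clause.** Beyond a table of length `L ≥ 1` (indices `0 … M`, `L = M + 1`): if `tail ≤ L + v − ⌊log_p L⌋`
then every coefficient `aₙ`, `n ≥ L`, is `0` or has valuation `≥ tail` — clause (iv) of `DescribesPadic`, from
integrality alone. [cite: Stoll2006IndependenceTwists, §6 proof of Prop. 6.3] -/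
theorem tail_le_valuation_of_integral {a : ℕ → ℚ_[p]} {v : ℤ}
    (hint : ∀ n, n ≠ 0 → a n = 0 ∨ (n : ℤ) + v ≤ ((n : ℚ_[p]) * a n).valuation)
    {L : ℕ} (hL : L ≠ 0) {tail : ℤ} (htail : tail ≤ (L : ℤ) + v - (Nat.log p L : ℤ))
    {n : ℕ} (hn : L ≤ n) : a n = 0 ∨ tail ≤ (a n).valuation := by
  have hn0 : n ≠ 0 := by omega
  rcases valuation_ge_of_integral hn0 (hint n hn0) with h0 | hv
  · exact Or.inl h0
  · right
    have hmono := tailBound_mono (p := p) v hn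
    simp only at hmono
    omega

/-- **A Strassman disc certificate DESCRIBES an integral disc antiderivative** as soon as (ii) the exact
coefficient `a_k ≠ 0` has valuation `e`, (iii) the tabulated coefficients respect the table, and the certificate's
tail bound is at most `T = L + v − ⌊log_p L⌋` (`L` = table length): clauses (i) «`aₙ → 0`» and (iv) «tail» of
`DescribesPadic` are CONSEQUENCES of `n·aₙ ∈ p^{n+v}ℤ_p` (`n ≥ 1`).
[cite: Stoll2006IndependenceTwists, §6 proof of Prop. 6.3] [cite: Gouvea1993PadicNumbers, §5.6 Thm. 5.6.1] -/
theorem describesPadic_of_integral (c : StrassmannDiscCert) {a : ℕ → ℚ_[p]} {v : ℤ}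
    (hint : ∀ n, n ≠ 0 → a n = 0 ∨ (n : ℤ) + v ≤ ((n : ℚ_[p]) * a n).valuation)
    (hk : a c.k ≠ 0) (he : (a c.k).valuation = c.e)
    (htab : ∀ n < c.table.length, n ≠ c.k → a n = 0 ∨ c.lb n ≤ (a n).valuation)
    (hlen : c.table.length ≠ 0)
    (htail : c.tail ≤ (c.table.length : ℤ) + v - (Nat.log p c.table.length : ℤ)) :
    c.DescribesPadic a := by
  refine ⟨tendsto_zero_of_integral hint, hk, he, fun n hnk => ?_⟩
  by_cases hlt : n < c.table.length
  · exact htab n hlt hnk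
  · rw [lb_of_length_le (not_lt.1 hlt)]
    exact tail_le_valuation_of_integral hint hlen htail (not_lt.1 hlt)

/-- **Consumption form for an integral disc antiderivative.** A literal certificate with `check = true`
(`decide`), the exact datum `a_k` (non-zero, valuation `e`), the tabulated bounds for `n ≤ M`, integrality
`n·aₙ ∈ p^{n+v}ℤ_p` (`n ≥ 1`) and `tail ≤ M + 1 + v − ⌊log_p(M+1)⌋`: then any finite set of zeros in `ℤ_p` of
`u ↦ Σ aₙuⁿ` has at most `k` elements. (Chabauty–Coleman: the rational points of the residue disc are such zeros by
Coleman's theorem — the consumer's named fact.)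
[cite: Gouvea1993PadicNumbers, §5.6 Thm. 5.6.1] [cite: Coleman1985EffectiveChabauty, §1 (ii)]
[cite: Stoll2006IndependenceTwists, §6 Prop. 6.3] -/
theorem card_le_of_zeros_padicInt_of_integral (c : StrassmannDiscCert) (hc : c.check = true)
    {a : ℕ → ℚ_[p]} {v : ℤ}
    (hint : ∀ n, n ≠ 0 → a n = 0 ∨ (n : ℤ) + v ≤ ((n : ℚ_[p]) * a n).valuation)
    (hk : a c.k ≠ 0) (he : (a c.k).valuation = c.e)
    (htab : ∀ n < c.table.length, n ≠ c.k → a n = 0 ∨ c.lb n ≤ (a n).valuation)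
    (htail : c.tail ≤ (c.table.length : ℤ) + v - (Nat.log p c.table.length : ℤ))
    (S : Finset ℤ_[p]) (hS : ∀ x ∈ S, ∑' n, a n * (x : ℚ_[p]) ^ n = 0) : S.card ≤ c.k := by
  have hlen : c.table.length ≠ 0 := by
    have hv := valid_of_check c hc
    exact fun h0 => by have := hv.1; omega
  exact card_le_of_zeros_padicInt c hc (describesPadic_of_integral c hint hk he htab hlen htail) S hS

/-- **The antiderivative shape gives integrality.** If `aₙ = pⁿ · b_{n−1} / n` for `n ≥ 1` with every `b_m` zero
or of valuation `≥ v` (the local expansion `Σ b_m t^m dt` of a differential with `p`-integral coefficients scaled by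
`p^v`, integrated termwise and evaluated at `t = p·u`), then `n·aₙ ∈ p^{n+v}ℤ_p`.
[cite: Stoll2006IndependenceTwists, §6 proof of Prop. 6.3 (λ(T) = c + Σ a_m π^{m+1} T^{m+1}/(m+1))] -/
theorem integral_of_antiderivative {a b : ℕ → ℚ_[p]} {v : ℤ}
    (hb : ∀ m, b m = 0 ∨ v ≤ (b m).valuation)
    (ha : ∀ n, n ≠ 0 → a n = (p : ℚ_[p]) ^ n * b (n - 1) / n) (n : ℕ) (hn : n ≠ 0) :
    a n = 0 ∨ (n : ℤ) + v ≤ ((n : ℚ_[p]) * a n).valuation := by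
  have hn' : (n : ℚ_[p]) ≠ 0 := Nat.cast_ne_zero.2 hn
  have hp0 : (p : ℚ_[p]) ≠ 0 := Nat.cast_ne_zero.2 hp.out.ne_zero
  rcases hb (n - 1) with h0 | hv
  · left; rw [ha n hn, h0, mul_zero, zero_div]
  · by_cases hb0 : b (n - 1) = 0
    · left; rw [ha n hn, hb0, mul_zero, zero_div]
    · right
      have hmul : (n : ℚ_[p]) * a n = (p : ℚ_[p]) ^ n * b (n - 1) := by
        rw [ha n hn]; field_simp
      rw [hmul, Padic.valuation_mul (pow_ne_zero _ hp0) hb0, Padic.valuation_pow, Padic.valuation_p, mul_one]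
      omega


/-! ### Glue: from `p`-integral local expansions to the integrality hypothesis (appended 2026-08-29, certnum-nt-1 g4)

`PowerSeriesBranchIntegrality.lean` proves that the local expansions of the basis differentials have coefficients in
`ℤ_p` under the checker's unit checks; the lemmas below turn «`cᵢ` of valuation `≥ v`, `ηᵢ(m) ∈ ℤ_p`» into the
hypothesis `n·aₙ ∈ p^{n+v}ℤ_p` of this file, so that the only inputs of a kind-CC disc certificate left outside the
kernel are Coleman's theorem, the rank, Kedlaya's E-tail and the exact residues. -/

/-- Valuation/norm dictionary in `ℚ_p`: «`x = 0` or `v ≤ v_p(x)`» iff `‖x‖ ≤ p^{−v}`.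
[cite: Gouvea1993PadicNumbers, §5.6 (the p-adic absolute value |x| = p^{−v(x)})] -/
theorem eq_zero_or_le_valuation_iff_norm_le {x : ℚ_[p]} {v : ℤ} :
    (x = 0 ∨ v ≤ x.valuation) ↔ ‖x‖ ≤ (p : ℝ) ^ (-v) := by
  have hp1 : (1 : ℝ) < p := Nat.one_lt_cast.2 hp.out.one_lt
  by_cases hx : x = 0
  · simp only [hx, norm_zero, true_or, true_iff]; positivity
  · rw [Padic.norm_eq_zpow_neg_valuation hx, zpow_le_zpow_iff_right₀ hp1, neg_le_neg_iff]
    simp [hx]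

/-- **From integral expansions to the integrality hypothesis.** A linear combination `Σ cᵢ·ηᵢ` with every `cᵢ`
zero or of valuation `≥ v` and every `ηᵢ ∈ ℤ_p` is zero or of valuation `≥ v` (ultrametric inequality). With
`ηᵢ` = a coefficient of the local expansion of `xⁱdx/2y` (in `ℤ_p` by `BranchIntegrality.coeff_eta_mem` /
`coeff_mem_of_eval₂_eq`) and `cᵢ` the coefficients of the annihilating differential, this is the hypothesis
`v ≤ v_p(b_m)` of `integral_of_antiderivative`. [cite: Stoll2006IndependenceTwists, §6 proof of Prop. 6.3] -/
theorem comb_eq_zero_or_le_valuation {ι : Type*} (s : Finset ι) {c η : ι → ℚ_[p]} {v : ℤ}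
    (hc : ∀ i ∈ s, c i = 0 ∨ v ≤ (c i).valuation) (hη : ∀ i ∈ s, η i ∈ PadicInt.subring p) :
    (∑ i ∈ s, c i * η i) = 0 ∨ v ≤ (∑ i ∈ s, c i * η i).valuation := by
  have hp0 : (0 : ℝ) < p := by exact_mod_cast hp.out.pos
  rw [eq_zero_or_le_valuation_iff_norm_le]
  refine IsUltrametricDist.norm_sum_le_of_forall_le_of_nonneg (by positivity) fun i hi => ?_
  rw [norm_mul]
  have h1 : ‖c i‖ ≤ (p : ℝ) ^ (-v) := eq_zero_or_le_valuation_iff_norm_le.1 (hc i hi)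
  have h2 : ‖η i‖ ≤ 1 := (PadicInt.mem_subring_iff p).1 (hη i hi)
  calc ‖c i‖ * ‖η i‖ ≤ (p : ℝ) ^ (-v) * 1 := by gcongr
    _ = (p : ℝ) ^ (-v) := mul_one _

/-- **End-to-end integrality for a Coleman disc antiderivative.** If `aₙ = pⁿ·b_{n−1}/n` (`n ≥ 1`) with
`b_m = Σᵢ cᵢ·ηᵢ(m)`, every `cᵢ` zero or of valuation `≥ v`, and every `ηᵢ(m) ∈ ℤ_p` (the local expansions of the
basis differentials are `p`-integral — `PowerSeriesBranchIntegrality`), then `n·aₙ ∈ p^{n+v}ℤ_p`: the hypothesis of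
`describesPadic_of_integral` / `card_le_of_zeros_padicInt_of_integral` holds, so the Strassman disc certificate's
tail and convergence clauses are theorems, not inputs. [cite: Stoll2006IndependenceTwists, §6 proof of Prop. 6.3]
[cite: Gouvea1993PadicNumbers, §5.6 Thm. 5.6.1] -/
theorem integral_of_comb_antiderivative {ι : Type*} (s : Finset ι) {c : ι → ℚ_[p]} {η : ι → ℕ → ℚ_[p]}
    {a : ℕ → ℚ_[p]} {v : ℤ} (hc : ∀ i ∈ s, c i = 0 ∨ v ≤ (c i).valuation)
    (hη : ∀ i ∈ s, ∀ m, η i m ∈ PadicInt.subring p)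
    (ha : ∀ n, n ≠ 0 → a n = (p : ℚ_[p]) ^ n * (∑ i ∈ s, c i * η i (n - 1)) / n) (n : ℕ) (hn : n ≠ 0) :
    a n = 0 ∨ (n : ℤ) + v ≤ ((n : ℚ_[p]) * a n).valuation :=
  integral_of_antiderivative (b := fun m => ∑ i ∈ s, c i * η i m)
    (fun m => comb_eq_zero_or_le_valuation s hc fun i hi => hη i hi m) ha n hn

/-- Kernel check on the numbers of the certificates of record (B-ratp-1 (ii), `pub/certnum/certnum-nt-1/evidence/
bratp1-sd/`: `p = 7`, table length `M + 1 = 31`, `v = v_min = 1`): the emitted tail bound `31` is exactly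
`(M + 1) + v − ⌊log₇(M + 1)⌋`. [folklore] -/
example : ((31 : ℕ) : ℤ) + 1 - (Nat.log 7 31 : ℤ) = 31 := by norm_num

/-- … and Flynn's example of the same packet family (`p = 5`, table length `31`, `v = 1`): `31 + 1 − ⌊log₅ 31⌋ = 30`.
[folklore] -/
example : ((31 : ℕ) : ℤ) + 1 - (Nat.log 5 31 : ℤ) = 30 := by norm_num

end Literature.Computation.Certificates.StrassmannDiscCert
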